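import Summits.CriticalPhenomena.PercolationContinuityZ3.Theorems.PercNearOneGluingNoHeavyLowerTailSahiE3Saturation
import HarnessLib
import HarnessLib.Audit

/-!
# `NoHeavyLowerTail` (crux stmt-CriticalPhenomena-4575), Sahi programme P4: the saturation reduction for Sahi's `C₃`, ALL THREE SLOTS
# — `C₃` only has to be checked on TRI-SATURATED triples

Support file (cell `prim-l12`, seat P4; `--supports stmt-CriticalPhenomena-4575`).  Continues `…SahiE3Saturation` (single-slot
reduction `forall_latticeE3_nonneg_of_saturated`: growing a slot outside the core `A ∩ B` or shrinking it inside the core never increases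
`latticeE3`; operators `coreSat`, `genSat`; potential `satPot`).  No named facts, no conjectures, no sorries.

RESULTS:
* `satPot_le_of_core_grow` / `satPot_le_of_core_shrink` — the single-slot potential `satPot A B S = #(S ∖ K) + #(K ∖ S)` depends on `A, B`
  only through the core `K = A ∩ B`, and does not decrease when the core grows by points outside `S` or shrinks by points inside `S`;
* `satPot3 U A B` — the total potential (sum over the three slots), `≤ 3·#α`, symmetric (`satPot3_swap12/23`), and STRICTLY increased by
  a non-trivial `coreSat`/`genSat` move in the first slot (`satPot3_lt_coreSat`, `satPot3_lt_genSat`) — hence, by symmetry, in any slot;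
* `TriSaturated U A B` — every slot bi-saturated relative to the intersection of the other two (maximal non-members of each set lie in both
  other sets; minimal members of each set lie outside the intersection of the other two);
* `triSaturated_or_step` — a triple of up-sets is tri-saturated or admits a single-slot saturation move to a triple of up-sets with larger
  total potential and no larger `latticeE3`;
* **`forall_latticeE3_nonneg_of_triSaturated`** — for a nonnegative log-supermodular weight on a finite distributive lattice: if
  `latticeE3 μ U A B ≥ 0` for all TRI-SATURATED triples of up-sets then it holds for ALL triples of up-sets.  So Sahi's `C₃` (Kahn's
  Conjecture 5, indicator form) is EQUIVALENT to its restriction to tri-saturated triples.  Census (seat, exact): nontrivial tri-saturated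
  triples of up-sets of `{0,1}^k` number 2 at `k = 3` and 230 (22 `S₄`-orbits, 16 of them substitution-prime) at `k = 4`, of 1 540 resp.
  804 440 multiset triples; these are exactly the configurations at which the Lieb–Sahi single-function descent (LS22 Thm 2.9, chain base)
  gets stuck on a Boolean base.  [this work]
-/

namespace Summit.CriticalPhenomena.PercolationContinuityZ3.Theorems.C3Transport

open Finset Literature.Probability.LatticeModels

variable {α : Type*} [Fintype α] [DecidableEq α]

/-! ### All three slots: `C₃` reduces to triples bi-saturated in every slot 

The potential `satPot A B U` depends on `A, B` only through the core `A ∩ B`; when one slot is saturated the cores of the OTHER two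
slots change only by points that cannot alter their "wrong-side" counts, so the total potential over the three slots still increases.
Hence the three single-slot reductions can be interleaved: `forall_latticeE3_nonneg_of_triSaturated`. -/

section AllSlots

omit [Fintype α] in
/-- `satPot` through the core: if the core grows only by points outside `S`, the potential of `S` does not decrease. [this work] -/
theorem satPot_le_of_core_grow {A B A' B' S : Finset α} (hK : A ∩ B ⊆ A' ∩ B')
    (hout : ∀ z ∈ (A' ∩ B') \ (A ∩ B), z ∉ S) : satPot A B S ≤ satPot A' B' S := by
  unfold satPot
  have h1 : S \ (A' ∩ B') = S \ (A ∩ B) := by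
    ext z
    simp only [Finset.mem_sdiff]
    constructor
    · rintro ⟨hzS, hzK'⟩
      exact ⟨hzS, fun hzK => hzK' (hK hzK)⟩
    · rintro ⟨hzS, hzK⟩
      exact ⟨hzS, fun hzK' => hout z (Finset.mem_sdiff.2 ⟨hzK', hzK⟩) hzS⟩
  have h2 : (A ∩ B) \ S ⊆ (A' ∩ B') \ S := Finset.sdiff_subset_sdiff hK le_rfl
  rw [h1]
  exact Nat.add_le_add_left (Finset.card_le_card h2) _

omit [Fintype α] in
/-- `satPot` through the core: if the core shrinks only by points inside `S`, the potential of `S` does not decrease. [this work] -/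
theorem satPot_le_of_core_shrink {A B A' B' S : Finset α} (hK : A' ∩ B' ⊆ A ∩ B)
    (hin : ∀ z ∈ (A ∩ B) \ (A' ∩ B'), z ∈ S) : satPot A B S ≤ satPot A' B' S := by
  unfold satPot
  have h1 : (A' ∩ B') \ S = (A ∩ B) \ S := by
    ext z
    simp only [Finset.mem_sdiff]
    constructor
    · rintro ⟨hzK', hzS⟩
      exact ⟨hK hzK', hzS⟩
    · rintro ⟨hzK, hzS⟩
      exact ⟨by_contra fun hzK' => hzS (hin z (Finset.mem_sdiff.2 ⟨hzK, hzK'⟩)), hzS⟩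
  have h2 : S \ (A ∩ B) ⊆ S \ (A' ∩ B') := Finset.sdiff_subset_sdiff le_rfl hK
  rw [h1]
  exact Nat.add_le_add_right (Finset.card_le_card h2) _

/-- `latticeE3` is symmetric in its first two arguments (local copy of `…SahiC3CubeThreeFKGPrelim.latticeE3_comm₁₂`, kept
private to avoid that file's heavy imports). [folklore] -/
private theorem latticeE3_swap12 (μ : α → ℝ) (A B C : Finset α) : latticeE3 μ A B C = latticeE3 μ B A C := by
  unfold latticeE3; rw [Finset.inter_comm A B]; ring

/-- `latticeE3` is symmetric in its last two arguments. [folklore] -/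
private theorem latticeE3_swap23 (μ : α → ℝ) (A B C : Finset α) : latticeE3 μ A B C = latticeE3 μ A C B := by
  unfold latticeE3; rw [Finset.inter_assoc, Finset.inter_comm B C, ← Finset.inter_assoc]; ring

/-- The total potential of a triple: the three single-slot potentials (slot `U` with core `A ∩ B`, slot `A` with core `U ∩ B`, slot `B`
with core `U ∩ A`). [this work] -/
def satPot3 (U A B : Finset α) : ℕ := satPot A B U + satPot U B A + satPot U A B

/-- The total potential is at most three times the size of the lattice. [this work] -/
theorem satPot3_le (U A B : Finset α) : satPot3 U A B ≤ 3 * Fintype.card α := by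
  unfold satPot3
  have := satPot_le_card A B U; have := satPot_le_card U B A; have := satPot_le_card U A B
  omega

omit [Fintype α] in
/-- The total potential is invariant under swapping the first two slots. [this work] -/
theorem satPot3_swap12 (U A B : Finset α) : satPot3 A U B = satPot3 U A B := by
  unfold satPot3 satPot; rw [Finset.inter_comm A B, Finset.inter_comm U B, Finset.inter_comm A U]; omega

omit [Fintype α] in
/-- The total potential is invariant under swapping the last two slots. [this work] -/
theorem satPot3_swap23 (U A B : Finset α) : satPot3 U B A = satPot3 U A B := by
  unfold satPot3 satPot; rw [Finset.inter_comm B A, Finset.inter_comm U B, Finset.inter_comm U A]; omega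

variable [DistribLattice α] [DecidableLE α]

/-- A triple is TRI-SATURATED when every slot is bi-saturated relative to the intersection of the other two: maximal non-members of
each set lie in the other two sets, minimal members of each set lie outside their intersection. [this work] -/
def TriSaturated (U A B : Finset α) : Prop :=
  (coreSat A B U = U ∧ genSat A B U = U) ∧ (coreSat U B A = A ∧ genSat U B A = A) ∧ (coreSat U A B = B ∧ genSat U A B = B)

/-- Core-saturating the first slot strictly increases the total potential. [this work] -/
theorem satPot3_lt_coreSat {U A B : Finset α} (hU : IsUpperSet (U : Set α)) (hne : coreSat A B U ≠ U) :
    satPot3 U A B < satPot3 (coreSat A B U) A B := by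
  have h1 := satPot_lt_coreSat (A := A) (B := B) hU hne
  have hsub := subset_coreSat (A := A) (B := B) hU
  have hout : ∀ z ∈ coreSat A B U \ U, z ∉ A ∩ B := fun z hz => not_mem_inter_of_mem_coreSat_sdiff hz
  have h2 : satPot U B A ≤ satPot (coreSat A B U) B A := by
    refine satPot_le_of_core_grow (Finset.inter_subset_inter hsub le_rfl) fun z hz hzA => ?_
    obtain ⟨hz1, hz2⟩ := Finset.mem_sdiff.1 hz
    have hzU : z ∉ U := fun h => hz2 (Finset.mem_inter.2 ⟨h, (Finset.mem_inter.1 hz1).2⟩)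
    exact hout z (Finset.mem_sdiff.2 ⟨(Finset.mem_inter.1 hz1).1, hzU⟩) (Finset.mem_inter.2 ⟨hzA, (Finset.mem_inter.1 hz1).2⟩)
  have h3 : satPot U A B ≤ satPot (coreSat A B U) A B := by
    refine satPot_le_of_core_grow (Finset.inter_subset_inter hsub le_rfl) fun z hz hzB => ?_
    obtain ⟨hz1, hz2⟩ := Finset.mem_sdiff.1 hz
    have hzU : z ∉ U := fun h => hz2 (Finset.mem_inter.2 ⟨h, (Finset.mem_inter.1 hz1).2⟩)
    exact hout z (Finset.mem_sdiff.2 ⟨(Finset.mem_inter.1 hz1).1, hzU⟩) (Finset.mem_inter.2 ⟨(Finset.mem_inter.1 hz1).2, hzB⟩)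
  unfold satPot3; omega

/-- Generated-saturating the first slot strictly increases the total potential. [this work] -/
theorem satPot3_lt_genSat {U A B : Finset α} (hU : IsUpperSet (U : Set α)) (hne : genSat A B U ≠ U) :
    satPot3 U A B < satPot3 (genSat A B U) A B := by
  have h1 := satPot_lt_genSat (A := A) (B := B) hU hne
  have hsub := genSat_subset (A := A) (B := B) hU
  have hin : ∀ z ∈ U \ genSat A B U, z ∈ A ∩ B := fun z hz => mem_inter_of_mem_sdiff_genSat hz
  have h2 : satPot U B A ≤ satPot (genSat A B U) B A := by
    refine satPot_le_of_core_shrink (Finset.inter_subset_inter hsub le_rfl) fun z hz => ?_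
    obtain ⟨hz1, hz2⟩ := Finset.mem_sdiff.1 hz
    have hzG : z ∉ genSat A B U := fun h => hz2 (Finset.mem_inter.2 ⟨h, (Finset.mem_inter.1 hz1).2⟩)
    exact (Finset.mem_inter.1 (hin z (Finset.mem_sdiff.2 ⟨(Finset.mem_inter.1 hz1).1, hzG⟩))).1
  have h3 : satPot U A B ≤ satPot (genSat A B U) A B := by
    refine satPot_le_of_core_shrink (Finset.inter_subset_inter hsub le_rfl) fun z hz => ?_
    obtain ⟨hz1, hz2⟩ := Finset.mem_sdiff.1 hz
    have hzG : z ∉ genSat A B U := fun h => hz2 (Finset.mem_inter.2 ⟨h, (Finset.mem_inter.1 hz1).2⟩)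
    exact (Finset.mem_inter.1 (hin z (Finset.mem_sdiff.2 ⟨(Finset.mem_inter.1 hz1).1, hzG⟩))).2
  unfold satPot3; omega

/-- One saturation step on a triple of up-sets: either the triple is tri-saturated, or some single-slot saturation move produces a
triple of up-sets with strictly larger total potential and no larger `latticeE3`. [this work] -/
theorem triSaturated_or_step {μ : α → ℝ} (hμ₀ : 0 ≤ μ) (hμ : ∀ a b, μ a * μ b ≤ μ (a ⊓ b) * μ (a ⊔ b))
    {U A B : Finset α} (hU : IsUpperSet (U : Set α)) (hA : IsUpperSet (A : Set α)) (hB : IsUpperSet (B : Set α)) :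
    TriSaturated U A B ∨ ∃ U' A' B' : Finset α, IsUpperSet (U' : Set α) ∧ IsUpperSet (A' : Set α) ∧ IsUpperSet (B' : Set α) ∧
      satPot3 U A B < satPot3 U' A' B' ∧ latticeE3 μ U' A' B' ≤ latticeE3 μ U A B := by
  by_cases h1 : coreSat A B U = U
  swap
  · exact Or.inr ⟨coreSat A B U, A, B, isUpperSet_coreSat A B U, hA, hB, satPot3_lt_coreSat hU h1,
      latticeE3_coreSat_le hμ₀ hμ hU hA hB⟩
  by_cases h2 : genSat A B U = U
  swap
  · exact Or.inr ⟨genSat A B U, A, B, isUpperSet_genSat A B U, hA, hB, satPot3_lt_genSat hU h2, latticeE3_genSat_le hμ₀ hU⟩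
  by_cases h3 : coreSat U B A = A
  swap
  · refine Or.inr ⟨U, coreSat U B A, B, hU, isUpperSet_coreSat U B A, hB, ?_, ?_⟩
    · have P := satPot3_lt_coreSat (U := A) (A := U) (B := B) hA h3
      rw [satPot3_swap12 U A B, satPot3_swap12 U (coreSat U B A) B] at P
      exact P
    · have L := latticeE3_coreSat_le hμ₀ hμ hA hU hB
      rw [← latticeE3_swap12 μ U A B, ← latticeE3_swap12 μ U (coreSat U B A) B] at L
      exact L
  by_cases h4 : genSat U B A = A
  swap
  · refine Or.inr ⟨U, genSat U B A, B, hU, isUpperSet_genSat U B A, hB, ?_, ?_⟩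
    · have P := satPot3_lt_genSat (U := A) (A := U) (B := B) hA h4
      rw [satPot3_swap12 U A B, satPot3_swap12 U (genSat U B A) B] at P
      exact P
    · have L := latticeE3_genSat_le (μ := μ) (A := U) (B := B) hμ₀ hA
      rw [← latticeE3_swap12 μ U A B, ← latticeE3_swap12 μ U (genSat U B A) B] at L
      exact L
  by_cases h5 : coreSat U A B = B
  swap
  · refine Or.inr ⟨U, A, coreSat U A B, hU, hA, isUpperSet_coreSat U A B, ?_, ?_⟩
    · have P := satPot3_lt_coreSat (U := B) (A := U) (B := A) hB h5
      rw [satPot3_swap12 U B A, satPot3_swap23 U A B, satPot3_swap12 U (coreSat U A B) A,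
        satPot3_swap23 U A (coreSat U A B)] at P
      exact P
    · have L := latticeE3_coreSat_le hμ₀ hμ hB hU hA
      rw [← latticeE3_swap12 μ U B A, ← latticeE3_swap23 μ U A B, ← latticeE3_swap12 μ U (coreSat U A B) A,
        ← latticeE3_swap23 μ U A (coreSat U A B)] at L
      exact L
  by_cases h6 : genSat U A B = B
  swap
  · refine Or.inr ⟨U, A, genSat U A B, hU, hA, isUpperSet_genSat U A B, ?_, ?_⟩
    · have P := satPot3_lt_genSat (U := B) (A := U) (B := A) hB h6
      rw [satPot3_swap12 U B A, satPot3_swap23 U A B, satPot3_swap12 U (genSat U A B) A,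
        satPot3_swap23 U A (genSat U A B)] at P
      exact P
    · have L := latticeE3_genSat_le (μ := μ) (A := U) (B := A) hμ₀ hB
      rw [← latticeE3_swap12 μ U B A, ← latticeE3_swap23 μ U A B, ← latticeE3_swap12 μ U (genSat U A B) A,
        ← latticeE3_swap23 μ U A (genSat U A B)] at L
      exact L
  exact Or.inl ⟨⟨h1, h2⟩, ⟨h3, h4⟩, ⟨h5, h6⟩⟩

/-- **The saturation reduction, all slots.**  If `latticeE3 μ U A B ≥ 0` for every TRI-SATURATED triple of up-sets, then it holds
for every triple of up-sets (FKG weight on a finite distributive lattice): Sahi's `C₃` is equivalent to its restriction to triples in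
which the maximal non-members of each set lie in both other sets and the minimal members of each set lie outside the intersection of
the other two. [this work] -/
theorem forall_latticeE3_nonneg_of_triSaturated {μ : α → ℝ} (hμ₀ : 0 ≤ μ)
    (hμ : ∀ a b, μ a * μ b ≤ μ (a ⊓ b) * μ (a ⊔ b))
    (hsat : ∀ U A B : Finset α, IsUpperSet (U : Set α) → IsUpperSet (A : Set α) → IsUpperSet (B : Set α) →
      TriSaturated U A B → 0 ≤ latticeE3 μ U A B)
    (U A B : Finset α) (hU : IsUpperSet (U : Set α)) (hA : IsUpperSet (A : Set α)) (hB : IsUpperSet (B : Set α)) :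
    0 ≤ latticeE3 μ U A B := by
  suffices H : ∀ n : ℕ, ∀ U A B : Finset α, IsUpperSet (U : Set α) → IsUpperSet (A : Set α) → IsUpperSet (B : Set α) →
      3 * Fintype.card α ≤ satPot3 U A B + n → 0 ≤ latticeE3 μ U A B from
    H (3 * Fintype.card α) U A B hU hA hB (Nat.le_add_left _ _)
  intro n
  induction n with
  | zero =>
    intro U A B hU hA hB hcard
    rcases triSaturated_or_step hμ₀ hμ hU hA hB with hts | ⟨U', A', B', -, -, -, hlt, -⟩
    · exact hsat U A B hU hA hB hts
    · have := satPot3_le U' A' B'; omega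
  | succ n ih =>
    intro U A B hU hA hB hcard
    rcases triSaturated_or_step hμ₀ hμ hU hA hB with hts | ⟨U', A', B', hU', hA', hB', hlt, hle⟩
    · exact hsat U A B hU hA hB hts
    · exact le_trans (ih U' A' B' hU' hA' hB' (by omega)) hle

end AllSlots

end Summit.CriticalPhenomena.PercolationContinuityZ3.Theorems.C3Transport
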